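import Mathlib
import Literature.Combinatorics.Additive.TripleProductProperty

/-!
# Witness: `P_hyp(6) ≥ 2048`

An explicit TPP triple of volume `8·16·16 = 2048` inside the centralisers of three fixed-point-free
involutions of `Fin 6` (pairwise-Hamiltonian matchings), i.e. the matrix of `¬ HyperoctahedralSubsets` /
`HyperoctahedralThreshold` at `n = 6` with `2048` in place of the threshold.  `(6!)^(3/2) ≈ 19 320`, so the
best hosted TPP triple at `n = 6` reaches the fraction `0.106` of the packing bound (`0.272` at `n = 4`).
The TPP is checked through explicit quotient sets (`tpp_of_quot6`, Cohn–Umans 2003 Def. 2.1) by evaluation.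
-/

namespace Summit.MatrixMultiplication.MatrixMultiplication.Theorems.HyperoctahedralThreshold.Negative

set_option linter.dupNamespace false

open Literature.Combinatorics.Additive

/-- TPP from explicit quotient sets: if `Qᵢ` are the right quotient sets `{x y⁻¹}` of `S, T, U` and the
only triple `(q₀, q₁, q₂) ∈ Q₀ × Q₁ × Q₂` with `q₀q₁q₂ = 1` is the trivial one, then `(S, T, U)` has the
triple product property (Cohn–Umans 2003, Def. 2.1, quotient-set form; the product set is written so
that a decision procedure materialises it once). [cite: CohnUmans2003, Def. 2.1] -/
theorem tpp_of_quot6 {G : Type*} [Group G] [DecidableEq G] {S T U : Finset G} (Q₀ Q₁ Q₂ : Finset G)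
    (h₀ : Finset.image₂ (fun a b => a * b⁻¹) S S = Q₀) (h₁ : Finset.image₂ (fun a b => a * b⁻¹) T T = Q₁)
    (h₂ : Finset.image₂ (fun a b => a * b⁻¹) U U = Q₂)
    (h : (Q₀ ×ˢ Q₁ ×ˢ Q₂).filter (fun x => x.1 * x.2.1 * x.2.2 = 1) ⊆ {((1 : G), (1 : G), (1 : G))}) :
    TripleProductProperty S T U := by
  intro s hs s' hs' t ht t' ht' u hu u' hu' heq
  have hq0 : s * s'⁻¹ ∈ Q₀ := h₀ ▸ Finset.mem_image₂_of_mem hs hs'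
  have hq1 : t * t'⁻¹ ∈ Q₁ := h₁ ▸ Finset.mem_image₂_of_mem ht ht'
  have hq2 : u * u'⁻¹ ∈ Q₂ := h₂ ▸ Finset.mem_image₂_of_mem hu hu'
  have hmem : (s * s'⁻¹, t * t'⁻¹, u * u'⁻¹) ∈
      (Q₀ ×ˢ Q₁ ×ˢ Q₂).filter (fun x => x.1 * x.2.1 * x.2.2 = 1) := by
    simp only [Finset.mem_filter, Finset.mem_product]
    exact ⟨⟨hq0, hq1, hq2⟩, heq⟩
  have := Finset.mem_singleton.1 (h hmem)
  simp only [Prod.mk.injEq] at this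
  obtain ⟨e0, e1, e2⟩ := this
  exact ⟨mul_inv_eq_one.1 e0, mul_inv_eq_one.1 e1, mul_inv_eq_one.1 e2⟩

/-- **Witness for `P_hyp(6) ≥ 2048 = (6!)^{3/2}·0.106`**: three fixed-point-free involutions of `Fin 6` whose matchings are pairwise Hamiltonian (host class 7 of `Census6Data`) and a TPP triple of SUBGROUPS of orders 8, 16, 16 of their centralisers `≅ S_2 ≀ S_3` — found by subgroup-lattice enumeration (ccert seat), matching the sibling census (Cruxes/HyperoctahedralSubsets/Disproof.lean §5) and refuting the smaller 'optimum 1728' recorded for these hosts elsewhere. Checked by evaluation. [folklore] -/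
theorem hyp6_witness :
    ∃ μ : Fin 3 → Equiv.Perm (Fin 6), (∀ i, μ i * μ i = 1 ∧ ∀ x, μ i x ≠ x) ∧
      ∃ X : Fin 3 → Finset (Equiv.Perm (Fin 6)), (∀ i, ∀ σ ∈ X i, σ * μ i = μ i * σ) ∧
        TripleProductProperty (X 0) (X 1) (X 2) ∧ (X 0).card * (X 1).card * (X 2).card = 2048 := by
  refine ⟨![Equiv.swap (0 : Fin 6) 1 * Equiv.swap (2 : Fin 6) 3 * Equiv.swap (4 : Fin 6) 5, Equiv.swap (0 : Fin 6) 2 * Equiv.swap (1 : Fin 6) 4 * Equiv.swap (3 : Fin 6) 5, Equiv.swap (0 : Fin 6) 5 * Equiv.swap (1 : Fin 6) 3 * Equiv.swap (2 : Fin 6) 4], by native_decide,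
    ![([1, Equiv.swap (2 : Fin 6) 3 * Equiv.swap (4 : Fin 6) 5, Equiv.swap (0 : Fin 6) 1 * Equiv.swap (4 : Fin 6) 5, Equiv.swap (0 : Fin 6) 1 * Equiv.swap (2 : Fin 6) 3, Equiv.swap (0 : Fin 6) 5 * Equiv.swap (0 : Fin 6) 1 * Equiv.swap (0 : Fin 6) 4, Equiv.swap (0 : Fin 6) 4 * Equiv.swap (1 : Fin 6) 5 * Equiv.swap (2 : Fin 6) 3, Equiv.swap (0 : Fin 6) 4 * Equiv.swap (0 : Fin 6) 1 * Equiv.swap (0 : Fin 6) 5, Equiv.swap (0 : Fin 6) 5 * Equiv.swap (1 : Fin 6) 4 * Equiv.swap (2 : Fin 6) 3] : List (Equiv.Perm (Fin 6))).toFinset,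
      ([1, Equiv.swap (3 : Fin 6) 5, Equiv.swap (1 : Fin 6) 4, Equiv.swap (1 : Fin 6) 4 * Equiv.swap (3 : Fin 6) 5, Equiv.swap (0 : Fin 6) 1 * Equiv.swap (2 : Fin 6) 4, Equiv.swap (0 : Fin 6) 1 * Equiv.swap (2 : Fin 6) 4 * Equiv.swap (3 : Fin 6) 5, Equiv.swap (0 : Fin 6) 4 * Equiv.swap (0 : Fin 6) 2 * Equiv.swap (0 : Fin 6) 1, Equiv.swap (0 : Fin 6) 4 * Equiv.swap (0 : Fin 6) 2 * Equiv.swap (0 : Fin 6) 1 * Equiv.swap (3 : Fin 6) 5, Equiv.swap (0 : Fin 6) 2, Equiv.swap (0 : Fin 6) 2 * Equiv.swap (3 : Fin 6) 5, Equiv.swap (0 : Fin 6) 2 * Equiv.swap (1 : Fin 6) 4, Equiv.swap (0 : Fin 6) 2 * Equiv.swap (1 : Fin 6) 4 * Equiv.swap (3 : Fin 6) 5, Equiv.swap (0 : Fin 6) 1 * Equiv.swap (0 : Fin 6) 2 * Equiv.swap (0 : Fin 6) 4, Equiv.swap (0 : Fin 6) 1 * Equiv.swap (0 : Fin 6) 2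 * Equiv.swap (0 : Fin 6) 4 * Equiv.swap (3 : Fin 6) 5, Equiv.swap (0 : Fin 6) 4 * Equiv.swap (1 : Fin 6) 2, Equiv.swap (0 : Fin 6) 4 * Equiv.swap (1 : Fin 6) 2 * Equiv.swap (3 : Fin 6) 5] : List (Equiv.Perm (Fin 6))).toFinset,
      ([1, Equiv.swap (2 : Fin 6) 4, Equiv.swap (1 : Fin 6) 3, Equiv.swap (1 : Fin 6) 3 * Equiv.swap (2 : Fin 6) 4, Equiv.swap (0 : Fin 6) 2 * Equiv.swap (4 : Fin 6) 5, Equiv.swap (0 : Fin 6) 4 * Equiv.swap (0 : Fin 6) 5 * Equiv.swap (0 : Fin 6) 2, Equiv.swap (0 : Fin 6) 2 * Equiv.swap (1 : Fin 6) 3 * Equiv.swap (4 : Fin 6) 5, Equiv.swap (0 : Fin 6) 4 * Equiv.swap (0 : Fin 6) 5 * Equiv.swap (0 : Fin 6) 2 * Equiv.swap (1 : Fin 6) 3, Equiv.swap (0 : Fin 6) 2 * Equiv.swap (0 : Fin 6) 5 * Equiv.swap (0 : Fin 6) 4, Equiv.swap (0 : Fin 6) 4 * Equiv.swap (2 : Fin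 6) 5, Equiv.swap (0 : Fin 6) 2 * Equiv.swap (0 : Fin 6) 5 * Equiv.swap (0 : Fin 6) 4 * Equiv.swap (1 : Fin 6) 3, Equiv.swap (0 : Fin 6) 4 * Equiv.swap (1 : Fin 6) 3 * Equiv.swap (2 : Fin 6) 5, Equiv.swap (0 : Fin 6) 5, Equiv.swap (0 : Fin 6) 5 * Equiv.swap (2 : Fin 6) 4, Equiv.swap (0 : Fin 6) 5 * Equiv.swap (1 : Fin 6) 3, Equiv.swap (0 : Fin 6) 5 * Equiv.swap (1 : Fin 6) 3 * Equiv.swap (2 : Fin 6) 4] : List (Equiv.Perm (Fin 6))).toFinset],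
    by native_decide, ?_, by native_decide⟩
  exact tpp_of_quot6
    ([1, Equiv.swap (2 : Fin 6) 3 * Equiv.swap (4 : Fin 6) 5, Equiv.swap (0 : Fin 6) 1 * Equiv.swap (4 : Fin 6) 5, Equiv.swap (0 : Fin 6) 1 * Equiv.swap (2 : Fin 6) 3, Equiv.swap (0 : Fin 6) 5 * Equiv.swap (0 : Fin 6) 1 * Equiv.swap (0 : Fin 6) 4, Equiv.swap (0 : Fin 6) 4 * Equiv.swap (1 : Fin 6) 5 * Equiv.swap (2 : Fin 6) 3, Equiv.swap (0 : Fin 6) 4 * Equiv.swap (0 : Fin 6) 1 * Equiv.swap (0 : Fin 6) 5, Equiv.swap (0 : Fin 6) 5 * Equiv.swap (1 : Fin 6) 4 * Equiv.swap (2 : Fin 6) 3] : List (Equiv.Perm (Fin 6))).toFinset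
    ([1, Equiv.swap (3 : Fin 6) 5, Equiv.swap (1 : Fin 6) 4, Equiv.swap (1 : Fin 6) 4 * Equiv.swap (3 : Fin 6) 5, Equiv.swap (0 : Fin 6) 1 * Equiv.swap (2 : Fin 6) 4, Equiv.swap (0 : Fin 6) 1 * Equiv.swap (2 : Fin 6) 4 * Equiv.swap (3 : Fin 6) 5, Equiv.swap (0 : Fin 6) 4 * Equiv.swap (0 : Fin 6) 2 * Equiv.swap (0 : Fin 6) 1, Equiv.swap (0 : Fin 6) 4 * Equiv.swap (0 : Fin 6) 2 * Equiv.swap (0 : Fin 6) 1 * Equiv.swap (3 : Fin 6) 5, Equiv.swap (0 : Fin 6) 2, Equiv.swap (0 : Fin 6) 2 * Equiv.swap (3 : Fin 6) 5, Equiv.swap (0 : Fin 6) 2 * Equiv.swap (1 : Fin 6) 4, Equiv.swap (0 : Fin 6) 2 * Equiv.swap (1 : Fin 6) 4 * Equiv.swap (3 : Fin 6) 5, Equiv.swap (0 : Fin 6) 1 * Equiv.swap (0 : Fin 6) 2 * Equiv.swap (0 : Fin 6) 4, Equiv.swap (0 : Fin 6) 1 * Equiv.swap (0 : Fin 6) 2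 * Equiv.swap (0 : Fin 6) 4 * Equiv.swap (3 : Fin 6) 5, Equiv.swap (0 : Fin 6) 4 * Equiv.swap (1 : Fin 6) 2, Equiv.swap (0 : Fin 6) 4 * Equiv.swap (1 : Fin 6) 2 * Equiv.swap (3 : Fin 6) 5] : List (Equiv.Perm (Fin 6))).toFinset
    ([1, Equiv.swap (2 : Fin 6) 4, Equiv.swap (1 : Fin 6) 3, Equiv.swap (1 : Fin 6) 3 * Equiv.swap (2 : Fin 6) 4, Equiv.swap (0 : Fin 6) 2 * Equiv.swap (4 : Fin 6) 5, Equiv.swap (0 : Fin 6) 4 * Equiv.swap (0 : Fin 6) 5 * Equiv.swap (0 : Fin 6) 2, Equiv.swap (0 : Fin 6) 2 * Equiv.swap (1 : Fin 6) 3 * Equiv.swap (4 : Fin 6) 5, Equiv.swap (0 : Fin 6) 4 * Equiv.swap (0 : Fin 6) 5 * Equiv.swap (0 : Fin 6) 2 * Equiv.swap (1 : Fin 6) 3, Equiv.swap (0 : Fin 6) 2 * Equiv.swap (0 : Fin 6) 5 * Equiv.swap (0 : Fin 6) 4, Equiv.swap (0 : Fin 6) 4 * Equiv.swap (2 : Fin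 6) 5, Equiv.swap (0 : Fin 6) 2 * Equiv.swap (0 : Fin 6) 5 * Equiv.swap (0 : Fin 6) 4 * Equiv.swap (1 : Fin 6) 3, Equiv.swap (0 : Fin 6) 4 * Equiv.swap (1 : Fin 6) 3 * Equiv.swap (2 : Fin 6) 5, Equiv.swap (0 : Fin 6) 5, Equiv.swap (0 : Fin 6) 5 * Equiv.swap (2 : Fin 6) 4, Equiv.swap (0 : Fin 6) 5 * Equiv.swap (1 : Fin 6) 3, Equiv.swap (0 : Fin 6) 5 * Equiv.swap (1 : Fin 6) 3 * Equiv.swap (2 : Fin 6) 4] : List (Equiv.Perm (Fin 6))).toFinset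
    (by native_decide) (by native_decide) (by native_decide) (by native_decide)

end Summit.MatrixMultiplication.MatrixMultiplication.Theorems.HyperoctahedralThreshold.Negative
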